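import Mathlib
import Literature.RingTheory.CohomologyAnnihilator.Basic
import Literature.RingTheory.CohomologyAnnihilator.SyzygyBasic
import Literature.RingTheory.CohomologyAnnihilator.SyzygyDescent
import Summits.ResolutionOfSingularities.ResolutionOfSingularities.Theorems.HomologicalConductorNoZenoReflexiveSyzygy
import Summits.ResolutionOfSingularities.ResolutionOfSingularities.Theorems.HomologicalConductorPersistenceDualSyzygyLevel
import Summits.ResolutionOfSingularities.ResolutionOfSingularities.Theorems.HomologicalConductorPersistenceRecurrenceExclusion
import Summits.ResolutionOfSingularities.ResolutionOfSingularities.Theorems.HomologicalConductorPersistencePeriodicSaturationStage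
import HarnessLib

/-!
# Rung S-2 `PersistenceSurface` (stmt-ResolutionOfSingularities-19970) — `Sat₃` (hence `Sat₄`) at every
# GORENSTEIN stage: `ca(T) = ca³(T)` for a noetherian domain `T` with `Extⁱ_T(W, T) = 0` for all `i ≥ 3`

Route `ResolutionOfSingularities/HomologicalConductor`, chain W4.4b, rung S-2 `PersistenceSurface`
(stmt-ResolutionOfSingularities-19970), registered skeleton 1a77c002, stub
`stub_saturationFourSurfaceResidualFour : SaturationFourSurfaceResidual₄` (`ca(T_m) ⊆ ca⁴(T_m)` at the
two-dimensional residual stages).  [OURS · pure homological algebra over LANDED tree lemmas; AI-written, weaker than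
expert review; NOT a statement of the manuscript under study (Hironaka 2017) and no statement of that manuscript is
used.]  DEF-FREE: no new `def`, no conjecture.

This is the «Gorenstein ⇒ cosyzygy» step that `…PersistenceSaturationCriterion` (Σ6b §1) and CRUX-PLAN v9 §0 (o9b′)
left unformalised («no MCM / canonical-module API»).  No such API is needed: the tree's LEVEL LEMMA
(`PersistenceDualSyzygyLevel.exists_isSyzygy_dual_of_forall_ext_eq_zero'`, Auslander–Bridger) and CA0
(`NoZeno.SandwichCluster.isReflexive_of_isSyzygy_two`, second syzygies over a domain are reflexive) give it in
four lines.  For a commutative noetherian DOMAIN `T` whose self-injective dimension on finitely generated modules is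
at most `2` — hypothesis `hGor : ∀ W f.g., ∀ i ≥ 3, Extⁱ_T(W, T) = 0`, i.e. (for `T` local) «`T` is Gorenstein of
Krull dimension `≤ 2`» [Bruns–Herzog, Thm. 3.1.17] — we prove:

* `ext_eq_zero_of_shortExact_projective`, `ext_eq_zero_of_isSyzygy_one`, `ext_eq_zero_of_isSyzygy_two` —
  dimension shifting in the tree's `IsSyzygy` currency (`Extⁱ⁺¹(M, L) = 0 ⇒ Extⁱ(ΩM, L) = 0`, `i ≥ 1`; two steps);
* **`exists_isSyzygy_of_isSyzygy_two_of_ext_eq_zero`** — under `hGor`, every second syzygy module `K` of a finitely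
  generated module is an `s`-th syzygy module of a finitely generated module FOR EVERY `s`.  Proof: `K` is reflexive
  (CA0), `K ≅ K**`; `K*` is a second syzygy `Ω²Y` of a finitely generated `Y` (`exists_isSyzygy_two_dual'`), so
  `Extⁱ(K*, T) = Extⁱ⁺²(Y, T) = 0` for `i ≥ 1` (`hGor`), and the level lemma makes `K** = (K*)*` an `s`-th syzygy
  for every `s`;
* **`cohomologyAnnihilator_eq_three_of_ext_eq_zero`** — hence the retract property `(SC₂)` holds with identity
  retractions and `ca(T) = ca³(T)` (`RecurrenceExclusion.cohomologyAnnihilator_eq_of_forall_isSyzygy_retract_at`);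
  levelled form `cohomologyAnnihilatorOfDegree_eq_three_of_ext_eq_zero` (`caⁿ(T) = ca³(T)`, `n ≥ 3`);
* `ca_subset_caAt_of_ext_eq_zero` — ROUTE VOCABULARY: for a subalgebra stage `T ⊆ K` with `↥T` noetherian and
  `hGor` for `↥T`, the inline sets satisfy `ca T ⊆ caAt n T` for every `n ≥ 3`; in particular `Sat₄`
  (`ca T ⊆ caAt 4 T`, `ca_subset_caAt_four_of_ext_eq_zero`) — the `m`-th conjunct of `SaturationFourSurfaceResidual₄`
  at every Gorenstein stage (all complete-intersection stages of any codimension, e.g. `U_x(E₁₂)`, `U_x(Ẽ₈)`, every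
  non-hypersurface Gorenstein normal surface point), independently of the monic-hypersurface / edim-candidate clauses.

After this file the content of the fourth residual is located at the NON-Gorenstein two-dimensional stages (and the
Gorenstein input `hGor` is what a consumer must supply from a presentation).  Nothing is asserted about those.

References: M. Auslander, M. Bridger, *Stable module theory*, Mem. AMS 94 (1969) — totally reflexive modules are
infinite syzygies (mechanism, via the tree's level lemma); W. Bruns, J. Herzog, *Cohen–Macaulay rings*, rev. ed. 1998,
Thm. 3.1.17 (Gorenstein ⇔ finite self-injective dimension = dim) and Thm. 3.3.10 [`BrunsHerzog1998`];
S. B. Iyengar, R. Takahashi, *Annihilation of cohomology and strong generation of module categories*, IMRN 2016, §2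
[`IyengarTakahashi2014`].
-/

noncomputable section

-- single-problem summit: the doubled namespace component `ResolutionOfSingularities` is forced
set_option linter.dupNamespace false

namespace Summit.ResolutionOfSingularities.ResolutionOfSingularities.Theorems.HomologicalConductor.PersistenceSurfaceSaturationGorenstein

open CategoryTheory CategoryTheory.Abelian Literature.RingTheory.CohomologyAnnihilator
open Summit.ResolutionOfSingularities.ResolutionOfSingularities.Theorems.NoZeno.SandwichCluster
  (isReflexive_of_isSyzygy_two)
open Summit.ResolutionOfSingularities.ResolutionOfSingularities.Theorems.HomologicalConductor.PersistenceDualSyzygyLevel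
  (exists_isSyzygy_two_dual' exists_isSyzygy_dual_of_forall_ext_eq_zero')
open Summit.ResolutionOfSingularities.ResolutionOfSingularities.Theorems.HomologicalConductor.RecurrenceExclusion
  (cohomologyAnnihilator_eq_of_forall_isSyzygy_retract_at cohomologyAnnihilatorOfDegree_eq_of_forall_isSyzygy_retract_at)
open Summit.ResolutionOfSingularities.ResolutionOfSingularities.Theorems.HomologicalConductor.PeriodicSaturationStage
  (ca_subset_caAt_of_le)

universe u

/-! ## Dimension shifting in `IsSyzygy` currency -/

section Shift

variable {T : Type u} [CommRing T]

/-- **Dimension shift along `0 → K → P → K' → 0` with `P` projective**: for `i ≥ 1`,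
`Extⁱ⁺¹(K', L) = 0 ⇒ Extⁱ(K, L) = 0` (the connecting map `Extⁱ(K, L) → Extⁱ⁺¹(K', L)` is injective, its kernel
coming from `Extⁱ(P, L) = 0`). [cite: IyengarTakahashi2014, Remark 2.3] -/
theorem ext_eq_zero_of_shortExact_projective {K P K' : ModuleCat.{u} T} {f : K ⟶ P} {g : P ⟶ K'}
    {w : f ≫ g = 0} (hS : (ShortComplex.mk f g w).ShortExact) (hP : Projective P) (L : ModuleCat.{u} T)
    {i : ℕ} (hi : 1 ≤ i) (h : ∀ e' : Ext.{u} K' L (i + 1), e' = 0) (e : Ext.{u} K L i) : e = 0 := by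
  have hδ : hS.extClass.comp e (add_comm 1 i) = 0 := h _
  obtain ⟨x₂, hx₂⟩ := Ext.contravariant_sequence_exact₁ hS L e (add_comm 1 i) hδ
  obtain ⟨j, rfl⟩ : ∃ j, i = j + 1 := ⟨i - 1, by omega⟩
  haveI : Projective (ShortComplex.mk f g w).X₂ := hP
  rw [← hx₂, Ext.eq_zero_of_projective x₂, Ext.comp_zero]

/-- **Dimension shift along a first syzygy**: `K = Ω¹M`, `i ≥ 1`, `Extⁱ⁺¹(M, L) = 0 ⇒ Extⁱ(K, L) = 0`.
[cite: IyengarTakahashi2014, Remark 2.3] -/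
theorem ext_eq_zero_of_isSyzygy_one {M K : ModuleCat.{u} T} (hK : IsSyzygy 1 M K) (L : ModuleCat.{u} T)
    {i : ℕ} (hi : 1 ≤ i) (h : ∀ e' : Ext.{u} M L (i + 1), e' = 0) (e : Ext.{u} K L i) : e = 0 := by
  obtain ⟨P, -, hproj, f, g, w, hS⟩ := isSyzygy_one_iff.mp hK
  exact ext_eq_zero_of_shortExact_projective hS hproj L hi h e

/-- **Dimension shift along a second syzygy**: `K = Ω²M`, `i ≥ 1`, `Extⁱ⁺²(M, L) = 0 ⇒ Extⁱ(K, L) = 0`.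
[cite: IyengarTakahashi2014, Remark 2.3] -/
theorem ext_eq_zero_of_isSyzygy_two {M K : ModuleCat.{u} T} (hK : IsSyzygy 2 M K) (L : ModuleCat.{u} T)
    {i : ℕ} (hi : 1 ≤ i) (h : ∀ e' : Ext.{u} M L (i + 2), e' = 0) (e : Ext.{u} K L i) : e = 0 := by
  obtain ⟨K', P, hK', -, hproj, f, g, w, hS⟩ := hK
  refine ext_eq_zero_of_shortExact_projective hS hproj L hi (fun e' => ?_) e
  exact ext_eq_zero_of_isSyzygy_one hK' L (by omega) (fun e'' => h e'') e'

end Shift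

/-! ## Second syzygies are infinite syzygies when `Ext^{≥3}(mod T, T) = 0` -/

section Gorenstein

variable {T : Type u} [CommRing T] [IsDomain T] [IsNoetherianRing T]

/-- **Second syzygies are `s`-th syzygies for every `s`, over a noetherian domain with
`Extⁱ_T(W, T) = 0` for all finitely generated `W` and all `i ≥ 3`** (for `T` local: `T` Gorenstein of Krull
dimension `≤ 2`).  For `K = Ω²M` (`M` finitely generated): `K` is reflexive (CA0, `isReflexive_of_isSyzygy_two`),
`K* = Ω²Y` for a finitely generated `Y` (`exists_isSyzygy_two_dual'`), so `Extⁱ(K*, T) = Extⁱ⁺²(Y, T) = 0` for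
`i ≥ 1`, and the Auslander–Bridger level lemma (`exists_isSyzygy_dual_of_forall_ext_eq_zero'`) makes `K ≅ K**` an
`s`-th syzygy of a finitely generated module for every `s`. [cite: BrunsHerzog1998, Thm. 3.3.10] -/
theorem exists_isSyzygy_of_isSyzygy_two_of_ext_eq_zero
    (hGor : ∀ (W : ModuleCat.{u} T), Module.Finite T W → ∀ i : ℕ, 3 ≤ i →
      ∀ e : Ext.{u} W (ModuleCat.of T T) i, e = 0)
    {M K : ModuleCat.{u} T} (hM : Module.Finite T M) (hK : IsSyzygy 2 M K) (s : ℕ) :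
    ∃ X : ModuleCat.{u} T, Module.Finite T X ∧ IsSyzygy s X K := by
  haveI : Module.IsReflexive T K := isReflexive_of_isSyzygy_two M K hK
  haveI : Module.Finite T K := finite_of_isSyzygy 2 hM hK
  -- `K*` is finitely generated: it embeds in `(Tⁿ)*`
  haveI : Module.Finite T (Module.Dual T K) := by
    obtain ⟨n, π, hπ⟩ := Module.Finite.exists_fin' T K
    exact Module.Finite.of_injective π.dualMap (LinearMap.dualMap_injective_of_surjective hπ)
  obtain ⟨Y, hY, hY2⟩ := exists_isSyzygy_two_dual' (B := T) K
  have hvan : ∀ i : ℕ, 1 ≤ i →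
      ∀ e : Ext.{u} (ModuleCat.of T (Module.Dual T K)) (ModuleCat.of T T) i, e = 0 :=
    fun i hi e => ext_eq_zero_of_isSyzygy_two hY2 (ModuleCat.of T T) hi
      (fun e' => hGor Y hY (i + 2) (by omega) e') e
  obtain ⟨X, hX, hs⟩ := exists_isSyzygy_dual_of_forall_ext_eq_zero' (B := T) (Module.Dual T K) hvan s
  exact ⟨X, hX, hs.of_iso (Module.evalEquiv T K).symm.toModuleIso⟩

/-- **`(SC₂)` with identity retractions**: under `hGor`, every second syzygy module of a finitely generated module
IS a third syzygy module of a finitely generated module. [cite: BrunsHerzog1998, Thm. 3.3.10] -/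
theorem forall_isSyzygy_two_retract_three_of_ext_eq_zero
    (hGor : ∀ (W : ModuleCat.{u} T), Module.Finite T W → ∀ i : ℕ, 3 ≤ i →
      ∀ e : Ext.{u} W (ModuleCat.of T T) i, e = 0) :
    ∀ (M K : ModuleCat.{u} T), Module.Finite T M → IsSyzygy 2 M K →
      ∃ (M' K' : ModuleCat.{u} T) (i : K ⟶ K') (r : K' ⟶ K),
        Module.Finite T M' ∧ IsSyzygy (2 + 1) M' K' ∧ i ≫ r = 𝟙 K := by
  intro M K hM hK
  obtain ⟨X, hX, h3⟩ := exists_isSyzygy_of_isSyzygy_two_of_ext_eq_zero hGor hM hK 3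
  exact ⟨X, K, 𝟙 K, 𝟙 K, hX, h3, Category.comp_id _⟩

/-- **`Sat₃` at a Gorenstein stage: `ca(T) = ca³(T)`** for a noetherian domain `T` with `Extⁱ_T(W, T) = 0` for
all finitely generated `W` and all `i ≥ 3` (saturation from one level, `(SC₂)`).
[cite: IyengarTakahashi2014, §2; BrunsHerzog1998, Thm. 3.3.10] -/
theorem cohomologyAnnihilator_eq_three_of_ext_eq_zero
    (hGor : ∀ (W : ModuleCat.{u} T), Module.Finite T W → ∀ i : ℕ, 3 ≤ i →
      ∀ e : Ext.{u} W (ModuleCat.of T T) i, e = 0) :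
    cohomologyAnnihilator T = cohomologyAnnihilatorOfDegree T 3 :=
  cohomologyAnnihilator_eq_of_forall_isSyzygy_retract_at (T := T) 2
    (forall_isSyzygy_two_retract_three_of_ext_eq_zero hGor)

/-- Levelled form: `caⁿ(T) = ca³(T)` for every `n ≥ 3` under `hGor`. [cite: IyengarTakahashi2014, §2] -/
theorem cohomologyAnnihilatorOfDegree_eq_three_of_ext_eq_zero
    (hGor : ∀ (W : ModuleCat.{u} T), Module.Finite T W → ∀ i : ℕ, 3 ≤ i →
      ∀ e : Ext.{u} W (ModuleCat.of T T) i, e = 0) {n : ℕ} (hn : 3 ≤ n) :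
    cohomologyAnnihilatorOfDegree T n = cohomologyAnnihilatorOfDegree T 3 :=
  cohomologyAnnihilatorOfDegree_eq_of_forall_isSyzygy_retract_at (T := T) 2
    (forall_isSyzygy_two_retract_three_of_ext_eq_zero hGor) hn

end Gorenstein

/-! ## Route vocabulary: `Satₙ` (`n ≥ 3`), in particular `Sat₄`, at a Gorenstein stage -/

section Stage

variable {k K : Type u} [Field k] [Field K] [Algebra k K]

/-- **`Satₙ` at a Gorenstein stage, route vocabulary.** For a subalgebra stage `T ⊆ K` with `↥T` noetherian and
`Extⁱ_{↥T}(W, ↥T) = 0` for all finitely generated `W`, `i ≥ 3`: the INLINE sets of the route satisfy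
`ca T ⊆ caAt n T` for every `n ≥ 3` (`cohomologyAnnihilator_eq_three_of_ext_eq_zero` + the adapter
`PeriodicSaturationStage.ca_subset_caAt_of_le`). [cite: IyengarTakahashi2014, §2] -/
theorem ca_subset_caAt_of_ext_eq_zero (T : Subalgebra k K) [IsNoetherianRing ↥T]
    (hGor : ∀ (W : ModuleCat.{u} ↥T), Module.Finite ↥T W → ∀ i : ℕ, 3 ≤ i →
      ∀ e : Ext.{u} W (ModuleCat.of ↥T ↥T) i, e = 0) {n : ℕ} (hn : 3 ≤ n) :
    {x : K | ∃ hx : x ∈ T, ∃ m : ℕ, ∀ i : ℕ, m ≤ i → ∀ (M N : ModuleCat.{u} ↥T),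
        Module.Finite ↥T M → Module.Finite ↥T N →
          ∀ e : CategoryTheory.Abelian.Ext.{u} M N i, (⟨x, hx⟩ : ↥T) • e = 0} ⊆
      {x : K | ∃ hx : x ∈ T, ∀ i : ℕ, n ≤ i → ∀ (M N : ModuleCat.{u} ↥T),
        Module.Finite ↥T M → Module.Finite ↥T N →
          ∀ e : CategoryTheory.Abelian.Ext.{u} M N i, (⟨x, hx⟩ : ↥T) • e = 0} :=
  ca_subset_caAt_of_le T
    ((cohomologyAnnihilator_eq_three_of_ext_eq_zero (T := ↥T) hGor).le.trans
      (cohomologyAnnihilatorOfDegree_mono hn))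

/-- **`Sat₄` at a Gorenstein stage** — the `m`-th conjunct of `SaturationFourSurfaceResidual₄` /
`SaturationFourSurface` for a stage `↥(tower O A m) = ↥T` with `Extⁱ(W, ↥T) = 0` for all finitely generated `W`,
`i ≥ 3`: `ca T ⊆ caAt 4 T`. [cite: IyengarTakahashi2014, §2] -/
theorem ca_subset_caAt_four_of_ext_eq_zero (T : Subalgebra k K) [IsNoetherianRing ↥T]
    (hGor : ∀ (W : ModuleCat.{u} ↥T), Module.Finite ↥T W → ∀ i : ℕ, 3 ≤ i →
      ∀ e : Ext.{u} W (ModuleCat.of ↥T ↥T) i, e = 0) :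
    {x : K | ∃ hx : x ∈ T, ∃ m : ℕ, ∀ i : ℕ, m ≤ i → ∀ (M N : ModuleCat.{u} ↥T),
        Module.Finite ↥T M → Module.Finite ↥T N →
          ∀ e : CategoryTheory.Abelian.Ext.{u} M N i, (⟨x, hx⟩ : ↥T) • e = 0} ⊆
      {x : K | ∃ hx : x ∈ T, ∀ i : ℕ, 4 ≤ i → ∀ (M N : ModuleCat.{u} ↥T),
        Module.Finite ↥T M → Module.Finite ↥T N →
          ∀ e : CategoryTheory.Abelian.Ext.{u} M N i, (⟨x, hx⟩ : ↥T) • e = 0} :=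
  ca_subset_caAt_of_ext_eq_zero T hGor (by norm_num)

end Stage

/-! ## Interface with Mathlib's injective dimension: `HasInjectiveDimensionLE T 2` (appended) -/

section InjectiveDimension

variable {T : Type u} [CommRing T] [IsDomain T] [IsNoetherianRing T]

omit [IsDomain T] [IsNoetherianRing T] in
/-- **The Gorenstein input from Mathlib's injective dimension.**  If `T`, as a module over itself, has injective
dimension `≤ 2` in `ModuleCat T` (`HasInjectiveDimensionLT (ModuleCat.of T T) 3`: `Extⁱ(Y, T) = 0` for all `Y` and
all `i ≥ 3` — for a noetherian local ring this is «`T` Gorenstein of Krull dimension `≤ 2`»), then the hypothesis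
`hGor` of this file holds. [cite: BrunsHerzog1998, Thm. 3.1.17] -/
theorem ext_eq_zero_of_hasInjectiveDimensionLT [HasInjectiveDimensionLT (ModuleCat.of T T) 3] :
    ∀ (W : ModuleCat.{u} T), Module.Finite T W → ∀ i : ℕ, 3 ≤ i →
      ∀ e : Ext.{u} W (ModuleCat.of T T) i, e = 0 :=
  fun _ _ _ hi e => e.eq_zero_of_hasInjectiveDimensionLT 3 hi

/-- **`Sat₃` from injective dimension `≤ 2`**: `ca(T) = ca³(T)` for a noetherian domain `T` with
`HasInjectiveDimensionLT (ModuleCat.of T T) 3`. [cite: BrunsHerzog1998, Thm. 3.3.10; IyengarTakahashi2014, §2] -/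
theorem cohomologyAnnihilator_eq_three_of_hasInjectiveDimensionLT [HasInjectiveDimensionLT (ModuleCat.of T T) 3] :
    cohomologyAnnihilator T = cohomologyAnnihilatorOfDegree T 3 :=
  cohomologyAnnihilator_eq_three_of_ext_eq_zero (T := T) ext_eq_zero_of_hasInjectiveDimensionLT

/-- **Second syzygies are `s`-th syzygies for every `s`** over a noetherian domain of self-injective dimension `≤ 2`
(Mathlib's `HasInjectiveDimensionLT (ModuleCat.of T T) 3`). [cite: BrunsHerzog1998, Thm. 3.3.10] -/
theorem exists_isSyzygy_of_isSyzygy_two_of_hasInjectiveDimensionLT [HasInjectiveDimensionLT (ModuleCat.of T T) 3]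
    {M K : ModuleCat.{u} T} (hM : Module.Finite T M) (hK : IsSyzygy 2 M K) (s : ℕ) :
    ∃ X : ModuleCat.{u} T, Module.Finite T X ∧ IsSyzygy s X K :=
  exists_isSyzygy_of_isSyzygy_two_of_ext_eq_zero (T := T) ext_eq_zero_of_hasInjectiveDimensionLT hM hK s

end InjectiveDimension

section StageInjectiveDimension

variable {k K : Type u} [Field k] [Field K] [Algebra k K]

/-- **`Sat₄` at a stage of self-injective dimension `≤ 2`, route vocabulary**: for a subalgebra stage `T ⊆ K` with
`↥T` noetherian and `HasInjectiveDimensionLT (ModuleCat.of ↥T ↥T) 3`, `ca T ⊆ caAt 4 T`.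
[cite: IyengarTakahashi2014, §2] -/
theorem ca_subset_caAt_four_of_hasInjectiveDimensionLT (T : Subalgebra k K) [IsNoetherianRing ↥T]
    [HasInjectiveDimensionLT (ModuleCat.of ↥T ↥T) 3] :
    {x : K | ∃ hx : x ∈ T, ∃ m : ℕ, ∀ i : ℕ, m ≤ i → ∀ (M N : ModuleCat.{u} ↥T),
        Module.Finite ↥T M → Module.Finite ↥T N →
          ∀ e : CategoryTheory.Abelian.Ext.{u} M N i, (⟨x, hx⟩ : ↥T) • e = 0} ⊆
      {x : K | ∃ hx : x ∈ T, ∀ i : ℕ, 4 ≤ i → ∀ (M N : ModuleCat.{u} ↥T),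
        Module.Finite ↥T M → Module.Finite ↥T N →
          ∀ e : CategoryTheory.Abelian.Ext.{u} M N i, (⟨x, hx⟩ : ↥T) • e = 0} :=
  ca_subset_caAt_four_of_ext_eq_zero T ext_eq_zero_of_hasInjectiveDimensionLT

end StageInjectiveDimension

/-! ## Presented stages: transport along a ring isomorphism (appended) -/

section Presented

variable {k K : Type u} [Field k] [Field K] [Algebra k K]

/-- **`Satₙ` (`n ≥ 3`) at a stage PRESENTED as a Gorenstein ring**, route vocabulary: if the stage `↥T` is
ring-isomorphic to a noetherian domain `T'` with `Extⁱ_{T'}(W, T') = 0` for all finitely generated `W` and all `i ≥ 3`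
(e.g. a complete-intersection local ring of dimension `2`, once its self-injective dimension is certified), then
`ca T ⊆ caAt n T` for every `n ≥ 3` — `ca(T') = ca³(T')` (`cohomologyAnnihilator_eq_three_of_ext_eq_zero`) transported
along the isomorphism (`PeriodicSaturationStage.cohomologyAnnihilator_le_of_ringEquiv`).  The identification
`e : ↥T ≃+* T'` and the `Ext`-vanishing over `T'` are the consumer's input. [cite: IyengarTakahashi2014, §2] -/
theorem ca_subset_caAt_of_ringEquiv_of_ext_eq_zero (T : Subalgebra k K) {T' : Type u} [CommRing T'] [IsDomain T']
    [IsNoetherianRing T'] (e : ↥T ≃+* T')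
    (hGor' : ∀ (W : ModuleCat.{u} T'), Module.Finite T' W → ∀ i : ℕ, 3 ≤ i →
      ∀ x : Ext.{u} W (ModuleCat.of T' T') i, x = 0) {n : ℕ} (hn : 3 ≤ n) :
    {x : K | ∃ hx : x ∈ T, ∃ m : ℕ, ∀ i : ℕ, m ≤ i → ∀ (M N : ModuleCat.{u} ↥T),
        Module.Finite ↥T M → Module.Finite ↥T N →
          ∀ e : CategoryTheory.Abelian.Ext.{u} M N i, (⟨x, hx⟩ : ↥T) • e = 0} ⊆
      {x : K | ∃ hx : x ∈ T, ∀ i : ℕ, n ≤ i → ∀ (M N : ModuleCat.{u} ↥T),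
        Module.Finite ↥T M → Module.Finite ↥T N →
          ∀ e : CategoryTheory.Abelian.Ext.{u} M N i, (⟨x, hx⟩ : ↥T) • e = 0} :=
  ca_subset_caAt_of_le T
    ((PeriodicSaturationStage.cohomologyAnnihilator_le_of_ringEquiv e
      (cohomologyAnnihilator_eq_three_of_ext_eq_zero (T := T') hGor').le).trans
      (cohomologyAnnihilatorOfDegree_mono hn))

/-- **`Sat₄` at a stage presented as a ring of self-injective dimension `≤ 2`** (Mathlib
`HasInjectiveDimensionLT (ModuleCat.of T' T') 3`), route vocabulary: `ca T ⊆ caAt 4 T`. [cite: IyengarTakahashi2014, §2] -/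
theorem ca_subset_caAt_four_of_ringEquiv_of_hasInjectiveDimensionLT (T : Subalgebra k K) {T' : Type u} [CommRing T']
    [IsDomain T'] [IsNoetherianRing T'] [HasInjectiveDimensionLT (ModuleCat.of T' T') 3] (e : ↥T ≃+* T') :
    {x : K | ∃ hx : x ∈ T, ∃ m : ℕ, ∀ i : ℕ, m ≤ i → ∀ (M N : ModuleCat.{u} ↥T),
        Module.Finite ↥T M → Module.Finite ↥T N →
          ∀ e : CategoryTheory.Abelian.Ext.{u} M N i, (⟨x, hx⟩ : ↥T) • e = 0} ⊆
      {x : K | ∃ hx : x ∈ T, ∀ i : ℕ, 4 ≤ i → ∀ (M N : ModuleCat.{u} ↥T),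
        Module.Finite ↥T M → Module.Finite ↥T N →
          ∀ e : CategoryTheory.Abelian.Ext.{u} M N i, (⟨x, hx⟩ : ↥T) • e = 0} :=
  ca_subset_caAt_of_ringEquiv_of_ext_eq_zero T e (ext_eq_zero_of_hasInjectiveDimensionLT (T := T')) (by norm_num)

end Presented

/-! ## Transport of the Gorenstein input along ring isomorphisms (appended) -/

section Transport

variable {T T' : Type u} [CommRing T] [CommRing T']

/-- **The `Ext`-vanishing input transports along ring isomorphisms.**  If `e : T ≃+* T'` and
`Extⁱ_{T'}(W', T') = 0` for all finitely generated `W'` and all `i ≥ n`, then `Extⁱ_T(W, T) = 0` for all finitely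
generated `W` and all `i ≥ n`: restriction of scalars along `e⁻¹` is an exact equivalence `ModuleCat T ⥤ ModuleCat T'`
inducing a bijection on `Ext` (Mathlib `Functor.mapExt_bijective_of_preservesProjectiveObjects`), and it carries the
`T`-module `T` to a `T'`-module isomorphic to `T'` via `e`.  (Lets the section-by-section vanishing of
`…HypersurfaceSectionExt` be continued through any re-presentation of the intermediate rings.) [folklore] -/
theorem ext_eq_zero_of_ringEquiv (e : T ≃+* T') {n : ℕ}
    (h' : ∀ (W' : ModuleCat.{u} T'), Module.Finite T' W' → ∀ i : ℕ, n ≤ i →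
      ∀ x : Ext.{u} W' (ModuleCat.of T' T') i, x = 0)
    (W : ModuleCat.{u} T) (hW : Module.Finite T W) {i : ℕ} (hi : n ≤ i)
    (x : Ext.{u} W (ModuleCat.of T T) i) : x = 0 := by
  let G := ModuleCat.restrictScalars.{u} e.symm.toRingHom
  haveI := hW
  haveI : Module.Finite T' (G.obj W) := finite_compHom_of_ringEquiv e.symm W
  -- `G (T) ≅ T'` as `T'`-modules, via `e`
  let φₗ : (G.obj (ModuleCat.of T T)) ≃ₗ[T'] T' :=
    { toFun := fun t => e t
      invFun := fun t' => e.symm t'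
      map_add' := fun a b => map_add e a b
      map_smul' := fun t' t => by
        have h := map_mul e (e.symm t') t
        rw [RingEquiv.apply_symm_apply] at h
        exact h
      left_inv := fun t => e.symm_apply_apply t
      right_inv := fun t' => e.apply_symm_apply t' }
  let φ : G.obj (ModuleCat.of T T) ≅ ModuleCat.of T' T' := φₗ.toModuleIso
  apply (G.mapExt_bijective_of_preservesProjectiveObjects W (ModuleCat.of T T) i).1
  rw [map_zero]
  have h1 : (G.mapExtAddHom W (ModuleCat.of T T) i x).comp (Ext.mk₀ φ.hom) (add_zero i) = 0 :=
    h' _ inferInstance i hi _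
  calc G.mapExtAddHom W (ModuleCat.of T T) i x
      = ((G.mapExtAddHom W (ModuleCat.of T T) i x).comp (Ext.mk₀ φ.hom) (add_zero i)).comp
          (Ext.mk₀ φ.inv) (add_zero i) := by
        rw [Ext.comp_assoc_of_third_deg_zero, Ext.mk₀_comp_mk₀, Iso.hom_inv_id, Ext.comp_mk₀_id]
    _ = 0 := by rw [h1, Ext.zero_comp]

end Transport

end Summit.ResolutionOfSingularities.ResolutionOfSingularities.Theorems.HomologicalConductor.PersistenceSurfaceSaturationGorenstein

end
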